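import Literature.MathematicalPhysics.QuantumFieldTheory.Balaban1983to89.B9Thm311PosDefQknitAtKnitLetterLawFreeY

/-!
# `Balaban1983to89.B9Thm311DeltaAQIsUnitAtKnitRecordOfSections` — T. Bałaban, *Propagators for lattice gauge theories in a background field*, Commun. Math. Phys.
# **99** (1985) 389–434 [Balaban1985BackgroundPropagators], THEOREM 3.11 p. 416 ⇒ THEOREM 3.3 p. 399: `Δ_a^𝔮(U)` AT THE KNIT PAIR OF RECORD
# `(qKnitOfRecord, qsKnitOfRecord, parKnitY, GpY parKnitY)` IS INVERTIBLE ON PRINT's CLASS (3.35), for every section-carrying member above one threshold —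
# hence the GUARDED averaging-pair law `hunitA` of the knit Sect.-B step (n06-c `B9SectBStepUParGQOfMembers.sectBStepUParGQ_parSymYH_of_members`, the supplier
# of the knit certificate's displayed row `hBK`) IS A THEOREM for its own sub-families `(f, ιB, hι)` at the knit instance

statement-level skeleton of published theorems with citation tags; proofs where landed; nothing here is a claim about the Yang–Mills mass gap

THE PRINT.  Thm 3.11 p. 416 («the operators Δ′_a, G′, (Q′G′²Q′\*)⁻¹, Δ_a, G are positive definite» — hence invertible); Thm 3.3 p. 399 (the propagator
`G(U) = Δ_a(U)⁻¹` of (3.27) p. 395); (3.19) p. 393 (the knit transporters); (3.11)–(3.15) p. 393 (the averaging pair `Q`, `Q*`); (3.35) p. 396 (the cube class);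
[5] = *Averaging operations …*, Commun. Math. Phys. **98** (1985), Prop. 2 (52)–(53) p. 26, (139)–(147) pp. 39–40.

WHY THIS FILE (cell `pub-ymgap`, node N06, seat `dag-n06-j` gen 37 = bundle F5, row 17 at the knit record; CASCADE-K).  dag-n06-d's knit certificate «KA»
(`Thm/BalabanUVNodesN06AtOpsYSectEStKnitPairKA`) displays the coded Sect.-B step at the knit letters as ONE binder `hBK`; its supplier, dag-n06-c's
`B9SectBStepUParGQOfMembers.sectBStepUParGQ_parSymYH_of_members` (✓, CASCADE-K piece «K2-G»), is J-indexed along a sub-family `f : J → MemberY …` CARRYING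
SECTIONS `ιB j` of the carrier-block map `β` (`hι`) and displays five GUARDED laws of the averaging transporter `parA` — among them
`hunitA : ∀ j α₀ U, MInv ≤ (geo9Y (f j)).M → 0 < α₀ → (geo9Y (f j)).M·α₀ ≤ aInv → U ∈ (bg9YC 𝕄 SU(N) (extraYPb …) (f j)).Reg335 c₃₅ α₀ →
IsUnit (deltaAQY (f j).toKIdx (𝔮 j) (𝔮s j) (parA j) (GpY (f j).toKIdx (parA j)) U)`.  At the knit instance `(𝔮, 𝔮s, parA) := (qKnitOfRecord, qsKnitOfRecord, parKnitY)`
this is ROW 17's invertibility of `Δ_a^𝔮(U)` at the knit pair; this seat's gen-36 file `B9Thm311PosDefQknitAtKnitLetterLawFreeY` (✓) proves `Δ_a^𝔮(U)` there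
SYMMETRIC and POSITIVE DEFINITE, LAW-FREE, for every section-carrying member of (3.35) above one threshold (Theorem 3.3's block at `parKnitY` from
`B9Thm33DeltaAAtKnitLetterOfRegYP335`, the knit numerics folded into the guard) — and positive definite implies invertible (`B9Thm311ReadingCoords.isUnit_of_posDefTr`).
THIS FILE packages that as the `hunitA` binder VERBATIM, exactly as this seat's g31 `B9Thm310DeltaAIsUnitOfRegYP335AtLettersY.hunitA_of_sections` packaged the
straight-pair `hunitA` (consumed by n06-c `B9SectBStepUClosedSUOfSections`, folded by dag-n06-d ED.79 «UF»): every `f j` is section-carrying because the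
sub-family carries `hι`, n06-c's class-keyed reading `bg9YC … extraYPb` is print's class plus `0 ≤ α₀` (`B9SectBCodedClassR.reg335C_iff`), and the knit's floors
`hMd`∕`hMr` are met by raising `MInv`.

WHAT IS PROVED (sorry-free; 0 `def`).
* §1 ★★ `isUnit_deltaAQY_knitRecord_at_scMember` — `∃ M₁ a₁ > 0, ∀ x, Surjective β → M₁ ≤ M → ∀ α₀ > 0, M·α₀ ≤ a₁ → ∀ U ∈ (bg9YP 𝕄 SU(N) x).Reg335 c₃₅ α₀,
  IsUnit (deltaAQY x.toKIdx (qKnitOfRecord N θ x.toKIdx) (qsKnitOfRecord N θ x.toKIdx) (parKnitY x.toKIdx) (GpY x.toKIdx (parKnitY x.toKIdx)) U)`;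
  `isUnit_deltaAQY_knitRecord_at_scMemberY` — the same along n06-c's carrier `SCMemberY` by name.
* §2 ★★★ **`hunitAQ_knitRecord_of_sections`** (`[Nonempty (Fin N)]`, as the knit pair of record) — `∃ MInv₀ aInv > 0, ∀ MInv ≥ MInv₀, ∀ (f : J → MemberY …) (ιB) (hι) j α₀ U, MInv ≤ (geo9Y (f j)).M → 0 < α₀ →
  (geo9Y (f j)).M·α₀ ≤ aInv → U ∈ (bg9YC 𝕄 SU(N) (extraYPb 𝕄 SU(N)) (f j)).Reg335 c₃₅ α₀ →
  IsUnit (deltaAQY (f j).toKIdx (qKnitOfRecord N θ (f j).toKIdx) (qsKnitOfRecord N θ (f j).toKIdx) (parKnitY (f j).toKIdx) (GpY (f j).toKIdx (parKnitY (f j).toKIdx)) U)` —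
  n06-c's `hunitA` VERBATIM at the knit instance, behind `fun j α₀ U => …`.
HONEST SCOPE.  COMPOSITION of landed theorems (this seat's law-free row 17 at the knit record + the tree's «positive definite ⇒ unit»); nothing of [B9] newly asserted;
members WITHOUT a section (inner corners) are outside §1 — for `hunitA` this costs nothing since the Sect.-B step carries `hι`; whether the knit folds the display is
dag-n06-c's ∕ dag-n06-d's call; count-neutral; NOT a node discharge; finite 𝕋 members; nothing continuum ∕ OS ∕ mass gap ∕ Clay — the Yang–Mills mass gap is NOT proved
here.  No `sorry`, no `axiom`, no `instance`, no `notation`, no `def`.  NEW file.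
RELATED, NOT DUPLICATED (searched 2026-08-30: `rg -l "IsUnit \(deltaAQY"` over the [B9] directories = consumers and generic lemmas only — n06-c `B9SectBStepUParGQOfMembers`
(DISPLAYS it), `B9SectBG{FramesSelQY,L2GFrameSelQY,ReadCodedQY,WordDeltaAQY}`, def-Y `Node00/OpsYSectD{Q,CoordsQ}`, n06-d `…N06SectDUnitsAtPinsPhysQ.isUnit_deltaAQY_phys_of_posDefTr`
(from a DISPLAYED `PosDefTr`), `…N06SectDIdentitiesAtPinsPhysQ`, this seat's `B9Thm311ReadingAtLettersQ`; needles `DeltaAQIsUnitAtKnitRecord|hunitAQ_knitRecord|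
isUnit_deltaAQY_knitRecord` = ∅): g31 `B9Thm310DeltaAIsUnitOfRegYP335AtLettersY.hunitA_of_sections` (the straight pair `(QY, parSymY)` — the precedent, a different
operator), g36 `B9Thm311PosDefQknitAtKnitLetterLawFreeY` (positivity — USED).
-/

noncomputable section

namespace Literature.MathematicalPhysics.QuantumFieldTheory.Balaban1983to89.B9Thm311DeltaAQIsUnitAtKnitRecordOfSections

open Literature.MathematicalPhysics.QuantumFieldTheory.Balaban1983to89
open Node00 B9Thm311ReadingCoords B6KLevelCensusIndexV1 B6Ineq2142KLevelV1 B6GlobalChartV1 B9PinMembersKLevelV1 B9PinGeometryKLevelV1 B9GeoNormsKLevelV1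
  B9BackgroundsKLevelV1 B9BackgroundsKLevelV1P B7Prop2SpecialUnitary
open Literature.MathematicalPhysics.QuantumFieldTheory.Balaban1983to89.B9SectBCodedClassR (bg9YC extraYPb)
open Literature.MathematicalPhysics.QuantumFieldTheory.Balaban1983to89.B9SectionCarryingMembersV1 (SCMemberY)
open Literature.MathematicalPhysics.QuantumFieldTheory.Balaban1983to89.B9B8AveragingJunction (parKnitY)
open Literature.MathematicalPhysics.QuantumFieldTheory.Balaban1983to89.Node00.OpsYQLetter (qKnitOfRecord qsKnitOfRecord)
open Literature.MathematicalPhysics.QuantumFieldTheory.Balaban1983to89.B9Thm311PosDefQknitAtKnitLetterLawFreeY (symm_posDefTr_deltaAQY_knitRecord_at_scMember)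
open scoped Matrix.Norms.L2Operator

variable {N : ℕ} [Nonempty (Fin N)] (θ : Stage3Params) (Mstar : ℕ)

/-! ## §1 `Δ_a^𝔮(U)` at the knit pair of record is a unit (section-carrying members of (3.35)) -/

/-- ★★ **`Δ_a^𝔮(U)` AT THE KNIT PAIR OF RECORD IS INVERTIBLE** for every section-carrying member of print's class (3.35) above ONE threshold: there are `M₁, a₁ > 0`
such that for `β` onto, `M₁ ≦ M`, `0 < α₀`, `M·α₀ ≦ a₁` and every `SU(N)`-valued `U ∈ (bg9YP … x).Reg335 c₃₅ α₀`,
`IsUnit (deltaAQY x (qKnitOfRecord) (qsKnitOfRecord) parKnitY (GpY parKnitY) U)` — Theorem 3.11's positivity there (law-free,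
`symm_posDefTr_deltaAQY_knitRecord_at_scMember`) and «positive definite ⇒ unit» (`isUnit_of_posDefTr`).
[cite: Balaban1985BackgroundPropagators, Thm 3.11 p.416 + Thm 3.3 p.399 + (3.27) p.395 + (3.19) p.393 + (3.35) p.396; Balaban1985Averaging, Prop. 2 (52)–(53) p.26] -/
theorem isUnit_deltaAQY_knitRecord_at_scMember :
    ∃ M₁ a₁ : ℝ, 0 < M₁ ∧ 0 < a₁ ∧
    ∀ (x : MemberY θ.d₆ θ.ℓ₆ θ.hd' θ.hL' θ.b₀ θ.b₁ Mstar), Function.Surjective (β x.hN x.D x.hk) → M₁ ≤ (geo9Y x).M →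
      ∀ α₀ : ℝ, 0 < α₀ → (geo9Y x).M * α₀ ≤ a₁ →
      ∀ U : CfgY (Matrix (Fin N) (Fin N) ℂ) x.toKIdx,
        (bg9YP (Matrix (Fin N) (Fin N) ℂ) (specialUnitaryUnits (Fin N)) x).Reg335 c35Y α₀ U →
          IsUnit (deltaAQY x.toKIdx (qKnitOfRecord N θ x.toKIdx) (qsKnitOfRecord N θ x.toKIdx) (parKnitY x.toKIdx)
            (GpY x.toKIdx (parKnitY x.toKIdx)) U) := by
  obtain ⟨M₁, a₁, hM₁, ha₁, h⟩ := symm_posDefTr_deltaAQY_knitRecord_at_scMember (N := N) θ Mstar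
  exact ⟨M₁, a₁, hM₁, ha₁, fun x hsurj hM α₀ hα ha U hU => isUnit_of_posDefTr (h x hsurj hM α₀ hα ha U hU).2⟩

/-- ★ **THE SAME ALONG n06-c's CARRIER `SCMemberY` BY NAME** (`x := j.val`, `j.surjective_beta`; INHABITED beyond every threshold by
`B9SectionCarryingMembersV1.exists_scMember_ge`). [cite: Balaban1985BackgroundPropagators, Thm 3.11 p.416 + (3.19) p.393 + (3.35) p.396; Balaban1984PropagatorsII, (2.3) p.224 + (2.45) p.231] -/
theorem isUnit_deltaAQY_knitRecord_at_scMemberY :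
    ∃ M₁ a₁ : ℝ, 0 < M₁ ∧ 0 < a₁ ∧
    ∀ (j : SCMemberY θ.d₆ θ.ℓ₆ θ.hd' θ.hL' θ.b₀ θ.b₁ Mstar), M₁ ≤ (geo9Y j.val).M →
      ∀ α₀ : ℝ, 0 < α₀ → (geo9Y j.val).M * α₀ ≤ a₁ →
      ∀ U : CfgY (Matrix (Fin N) (Fin N) ℂ) j.val.toKIdx,
        (bg9YP (Matrix (Fin N) (Fin N) ℂ) (specialUnitaryUnits (Fin N)) j.val).Reg335 c35Y α₀ U →
          IsUnit (deltaAQY j.val.toKIdx (qKnitOfRecord N θ j.val.toKIdx) (qsKnitOfRecord N θ j.val.toKIdx) (parKnitY j.val.toKIdx)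
            (GpY j.val.toKIdx (parKnitY j.val.toKIdx)) U) := by
  obtain ⟨M₁, a₁, hM₁, ha₁, h⟩ := isUnit_deltaAQY_knitRecord_at_scMember (N := N) θ Mstar
  exact ⟨M₁, a₁, hM₁, ha₁, fun j hM α₀ hα ha U hU => h j.val j.surjective_beta hM α₀ hα ha U hU⟩

/-! ## §2 ★★★ n06-c's GUARDED `hunitA` at the knit instance, for its own sub-families -/

/-- ★★★ **THE KNIT SECT.-B STEP's GUARDED `hunitA` (n06-c `sectBStepUParGQ_parSymYH_of_members`, at `(𝔮, 𝔮s, parA) := (qKnitOfRecord, qsKnitOfRecord, parKnitY)`)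
IS A THEOREM FOR ITS OWN SUB-FAMILIES**: the step quantifies over a sub-family `f : J → MemberY …` TOGETHER WITH sections `ιB j` of `β` (`hι : ∀ j s, β (ιB j s) = s`) —
so every `f j` is section-carrying, and §1 applies: there are `MInv₀, aInv > 0` such that for every `MInv ≥ MInv₀` (the knit's `hMd`∕`hMr` floors are met by raising
`MInv`), every such `(f, ιB, hι)`, every `j`, `α₀`, `U`: `MInv ≤ M → 0 < α₀ → M·α₀ ≤ aInv → U ∈ (bg9YC 𝕄 SU(N) (extraYPb …) (f j)).Reg335 c₃₅ α₀ →
IsUnit (deltaAQY (f j).toKIdx (qKnitOfRecord …) (qsKnitOfRecord …) (parKnitY (f j).toKIdx) (GpY (f j).toKIdx (parKnitY (f j).toKIdx)) U)` — the binder `hunitA` VERBATIM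
at the knit instance (n06-c's class-keyed carrier `bg9YC … extraYPb` = print's class read with `0 ≤ α₀`, `B9SectBCodedClassR.reg335C_iff`).
[cite: Balaban1985BackgroundPropagators, Thm 3.11 p.416 («Δ_a … positive definite», hence invertible) + Thm 3.3 p.399 + (3.19) p.393 + (3.11)–(3.15) p.393 + (3.35) p.396; Balaban1985Averaging, Prop. 2 (52)–(53) p.26, (139)–(147) pp.39–40] -/
theorem hunitAQ_knitRecord_of_sections : ∃ MInv₀ aInv : ℝ, 0 < MInv₀ ∧ 0 < aInv ∧
    ∀ (MInv : ℝ), MInv₀ ≤ MInv →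
    ∀ {J : Type} (f : J → MemberY θ.d₆ θ.ℓ₆ θ.hd' θ.hL' θ.b₀ θ.b₁ Mstar) (ιB : ∀ j : J, BlkY (f j).toKIdx → IBondY (f j).toKIdx)
      (_hι : ∀ (j : J) (s : BlkY (f j).toKIdx), β (f j).toKIdx.hN (f j).toKIdx.D (f j).toKIdx.hk (ιB j s) = s)
      (j : J) (α₀ : ℝ) (U : CfgY (Matrix (Fin N) (Fin N) ℂ) (f j).toKIdx),
      MInv ≤ (geo9Y (f j)).M → 0 < α₀ → (geo9Y (f j)).M * α₀ ≤ aInv →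
      (bg9YC (Matrix (Fin N) (Fin N) ℂ) (specialUnitaryUnits (Fin N))
          (extraYPb (Matrix (Fin N) (Fin N) ℂ) (specialUnitaryUnits (Fin N))) (f j)).Reg335 c35Y α₀ U →
      IsUnit (deltaAQY (f j).toKIdx (qKnitOfRecord N θ (f j).toKIdx) (qsKnitOfRecord N θ (f j).toKIdx) (parKnitY (f j).toKIdx)
        (GpY (f j).toKIdx (parKnitY (f j).toKIdx)) U) := by
  obtain ⟨M₁, a₁, hM₁, ha₁, h⟩ := isUnit_deltaAQY_knitRecord_at_scMember (N := N) θ Mstar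
  refine ⟨M₁, a₁, hM₁, ha₁, fun MInv hMInv J f ιB hι j α₀ U hM hα ha hU => ?_⟩
  have hP : (bg9YP (Matrix (Fin N) (Fin N) ℂ) (specialUnitaryUnits (Fin N)) (f j)).Reg335 c35Y α₀ U := ⟨⟨hU.1.1, hU.1.2.2⟩, hU.2⟩
  exact h (f j) (fun s => ⟨ιB j s, hι j s⟩) (hMInv.trans hM) α₀ hα ha U hP

end Literature.MathematicalPhysics.QuantumFieldTheory.Balaban1983to89.B9Thm311DeltaAQIsUnitAtKnitRecordOfSections

end
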